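import Summits.KontsevichZagierPeriods.KontsevichZagierPeriods.Statement
import Summits.KontsevichZagierPeriods.KontsevichZagierPeriods.Theses.TorsionLogs
import Literature.NumberTheory.Transcendental.KZKernelConjectureForms
import Mathlib

/-!
# F4 ON-PATH LEMMA for the rung `NeronTorsionJets` (line `NeronTorsionVariation` on crux `TorsionSectorComplete`,
# stmt-KontsevichZagierPeriods-14212; forward generator G1 `next-rung`, gen 12, seed g1-KontsevichZagierPeriods-17981)

`theorem onPath : KontsevichZagierPeriods → NeronTorsionJets` — the summit implies the rung.  Member `false` (the
floor) is a theorem outright (`Theses.TorsionLogs.NeronTorsionPrimitiveChain_holds`); member `true` (the tied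
first-variation sector statement) follows from Conjecture 1 in kernel form (`kzKernelConjecture_iff_isRational`): the
element evaluates, by `KZ.eval_of`, to the value hypothesis, hence lies in `ker eval = relations`.  No `sorry`.
Self-contained: verbatim copies of the three `def`s of `Lines/NeronTorsionVariation.lean` in the namespace
`…NeronTorsionVariation.OnPath`; the `@[simp]` hypothesis-form theorem is the shape the tribunal's forward probe
`S → Rung` closes with. [cite: KontsevichZagier2001, §1.2]
-/

noncomputable section

-- `Summit.KontsevichZagierPeriods.KontsevichZagierPeriods.…` is the tree's mandated layout (single-conjunct summit).
set_option linter.dupNamespace false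

namespace Summit.KontsevichZagierPeriods.KontsevichZagierPeriods.Cruxes.TorsionSectorComplete.NeronTorsionVariation.OnPath

open Literature.NumberTheory.Transcendental
open Summit.KontsevichZagierPeriods.KontsevichZagierPeriods.Theses.TorsionLogs (NeronTorsionPrimitiveChain
  NeronTorsionPrimitiveChain_holds)

/-- Verbatim copy of `Lines/NeronTorsionVariation.lean :: NeronTorsionVariationSector` (member `true`, j = 1). -/
def NeronTorsionVariationSector : Prop :=
  ∀ (g₂ g₃ e₁ xP yP ξ β : ℝ) (N a p q : ℕ) (f : ℝ → ℝ),
    (∀ x, f x = 4 * x ^ 3 - g₂ * x - g₃) → g₂ ^ 3 - 27 * g₃ ^ 2 ≠ 0 → f e₁ = 0 → 0 < e₁ →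
    (∀ x, e₁ < x → 0 < f x) → e₁ < xP → yP ^ 2 = f xP → 3 ≤ N → 0 < a → 2 * a < N →
    (∀ hns : (⟨0, 0, 0, -g₂ / 4, -g₃ / 4⟩ : WeierstrassCurve ℝ).toAffine.Nonsingular xP (yP / 2),
      addOrderOf (WeierstrassCurve.Affine.Point.some xP (yP / 2) hns) = N) →
    (N : ℝ) * (∫ x in Set.Ioi xP, (Real.sqrt (f x))⁻¹) = a * (2 * ∫ x in Set.Ioi e₁, (Real.sqrt (f x))⁻¹) →
    Nat.Coprime p q → (q : ℤ) * ((N : ℤ) - 2 * (a : ℤ)) = (p : ℤ) * (2 * (N : ℤ)) →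
    (N : ℝ) * (-(ξ / Real.sqrt (f xP)) + ∫ x in Set.Ioi xP, (x - e₁) / (2 * Real.sqrt (f x) ^ 3)) =
      a * (2 * ∫ x in Set.Ioi e₁, (x - e₁) / (2 * Real.sqrt (f x) ^ 3)) →
    ∀ (r₁ rb : KZ.IntegralRep 1) (rD rW : KZ.IntegralRep 2),
    r₁.domain = {t | e₁ < t 0 ∧ t 0 < xP} →
    Set.EqOn r₁.integrand (fun t => ξ / Real.sqrt (f xP) * (t 0 / Real.sqrt (f (t 0)))) r₁.domain →
    rD.domain = {z | e₁ < z 1 ∧ z 1 < z 0 ∧ z 0 < xP} →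
    Set.EqOn rD.integrand (fun z => z 1 * ((z 1 - e₁) / (2 * Real.sqrt (f (z 1)) ^ 3 * Real.sqrt (f (z 0)))
      + (z 0 - e₁) / (2 * Real.sqrt (f (z 1)) * Real.sqrt (f (z 0)) ^ 3))) rD.domain →
    rW.domain = {z | e₁ < z 0 ∧ e₁ < z 1} →
    Set.EqOn rW.integrand (fun z => (z 0 - e₁) / (2 * Real.sqrt (f (z 0)) ^ 3) *
        ((g₂ * z 1 + 2 * g₃) / (2 * (z 1) ^ 2 * Real.sqrt (f (z 1))))
      + (Real.sqrt (f (z 0)))⁻¹ * ((z 1 - 2 * e₁) / (2 * (z 1) ^ 2 * Real.sqrt (f (z 1)))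
        + (g₂ * z 1 + 2 * g₃) * (z 1 - e₁) / (4 * (z 1) ^ 2 * Real.sqrt (f (z 1)) ^ 3))) rW.domain →
    rb.domain = {t | 0 < t 0 ∧ t 0 < 1} → Set.EqOn rb.integrand (fun _ => β) rb.domain →
    (q : ℝ) ^ 2 * (r₁.value + rD.value) + (p : ℝ) ^ 2 * rW.value = rb.value →
    ((q : ℤ) ^ 2) • (KZ.of r₁ + KZ.of rD) + ((p : ℤ) ^ 2) • KZ.of rW - KZ.of rb ∈ KZ.relations

/-- Verbatim copy of `Lines/NeronTorsionVariation.lean :: NeronTorsionJetMember` (the family, graded by jet order). -/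
def NeronTorsionJetMember : Bool → Prop
  | false => NeronTorsionPrimitiveChain
  | true => NeronTorsionVariationSector

/-- Verbatim copy of `Lines/NeronTorsionVariation.lean :: NeronTorsionJets` (THE RUNG). -/
def NeronTorsionJets : Prop := ∀ one : Bool, NeronTorsionJetMember one

/-- **The summit implies the new member** (Conjecture 1, kernel form). -/
@[simp] theorem variationSector_of_kontsevichZagierPeriods (h : _root_.KontsevichZagierPeriods) :
    NeronTorsionVariationSector := by
  have hK : KZKernelConjecture := kzKernelConjecture_iff_isRational.mpr h
  intro g₂ g₃ e₁ xP yP ξ β N a p q f _ _ _ _ _ _ _ _ _ _ _ _ _ _ _ r₁ rb rD rW _ _ _ _ _ _ _ _ hval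
  apply hK
  simp only [map_sub, map_add, map_zsmul, KZ.eval_of, zsmul_eq_mul]
  push_cast
  linear_combination hval

/-- **F4 ON-PATH (hypothesis form, `@[simp]`): the summit implies the rung.** -/
@[simp] theorem neronTorsionJets_of_kontsevichZagierPeriods (h : _root_.KontsevichZagierPeriods) :
    NeronTorsionJets := by
  rintro (_ | _)
  · exact NeronTorsionPrimitiveChain_holds
  · exact variationSector_of_kontsevichZagierPeriods h

/-- **F4 ON-PATH LEMMA** in the literal shape `S → Rung`. -/
theorem onPath : _root_.KontsevichZagierPeriods → NeronTorsionJets :=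
  neronTorsionJets_of_kontsevichZagierPeriods

end Summit.KontsevichZagierPeriods.KontsevichZagierPeriods.Cruxes.TorsionSectorComplete.NeronTorsionVariation.OnPath

end
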